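import Literature.Combinatorics.Sahi2008.Symmetry
import Literature.Combinatorics.Sahi2008.CumulationCone
import Summits.CriticalPhenomena.PercolationContinuityZ3.Theorems.PercNearOneGluingNoHeavyLowerTailSahiSlotPatternComb
import Summits.CriticalPhenomena.PercolationContinuityZ3.Theorems.PercNearOneGluingNoHeavyLowerTailSahiSlotPatternCopyKernel
import Summits.CriticalPhenomena.PercolationContinuityZ3.Theorems.PercNearOneGluingNoHeavyLowerTailSahiSlotPatternFace

/-!
# Symmetries of the order-`n` pattern functional: `patternForm` (equivalently `sStarN`) is a symmetric function of its `n`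
# arguments and is invariant under permuting the `d` axes — the soundness of sorted-tuple / axis-orbit censuses

Support file (lane `prim-masterthm-p3`, generation 18; `--supports stmt-CriticalPhenomena-4575`).  Pure proofs, no definitions,
no `sorry`, standard axioms.

The diagonal (cycle) form `diagForm` is NOT symmetric in its arguments (the least-element representative of a cycle depends on
the labelling), and neither kernel of the tree (`diagForm`, `SahiCopyKernel.copyKernel`) is; but the pattern sums are.  We prove a
general EXTRACTION PRINCIPLE (`sum_perm_eq_of_forall_gridW`): two kernels on slot families `r : Fin d → Fin n → Fin n` that have
the same `slotW g`-weighted sum for every family of probability weights `g` on the axes have the same sum over the `d`-tuples of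
permutations (uniform weights on sub-boxes + the surjective extraction `sum_perm_eq_zero_of_forall_into`).  Feeding it the bridge
`sahiE_gridW_eq_sum_diagForm` and the symmetries of `E_n` itself (`sahiE_comp_perm`, `sahiE_comp_equiv`) gives
* `patternForm_perm_slots`:   `patternForm d n (f ∘ π) = patternForm d n f` for `π ∈ S_n` (symmetric in the `n` functions);
* `patternForm_comp_axisPerm`: `patternForm d n (i ↦ f_i ∘ (q ↦ q ∘ ρ)) = patternForm d n f` for `ρ ∈ S_d` (axis relabelling);
and, through `sStarN_cast_eq_patternForm`, the same for `SahiGridPatternN.sStarN` (`sStarN_perm_slots`, `sStarN_axisPerm`).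
Together with the per-axis value relabelling invariance `patternForm_comp_act` these are exactly the reductions used by the
censuses of both lanes (sorted `n`-tuples of up-sets; orbits under the axis group).
Second part (section `FaceTransfer`): the slot face theorem of `…SahiSlotPatternFace` with the absorbed member in ANY slot
(`patternForm_setInd_nonneg_of_subset_at`), its `sStarN` form (`sStarN_nonneg_of_subset`), and the PROFILE DECOMPOSITION
`patternForm d (n+1) (g, F) = Σ_y g(y) · patternForm d (n+1) (1_{{y}}, F)` (`patternForm_cons_eq_sum_profile`; linearity in a slot) — the
first-slot profile `P_y(F)` of the census engines, nonnegative on `∩_j U_j` by `patternForm_single_nonneg`. [this work]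
-/

namespace Summit.CriticalPhenomena.PercolationContinuityZ3.Theorems

open Finset Function Equiv Equiv.Perm
open Literature.Combinatorics.Sahi2008 Literature.Combinatorics.Sahi2008.CycleForm
open Literature.Probability.LatticeModels

namespace SahiSlot

section Symmetry

open SahiGridPatternN (col sStarN)
open scoped Classical

variable {d n : ℕ}

/-- **Extraction principle.** Two kernels on slot families with the same `slotW g`-weighted sum for every family of probability
weights `g` on the axes have the same sum over `S_n^d` (`1 ≤ n`). [this work] -/
theorem sum_perm_eq_of_forall_gridW (hn : 1 ≤ n) (K₁ K₂ : (Fin d → Fin n → Fin n) → ℝ)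
    (h : ∀ g : Fin d → Fin n → ℝ, (∀ a, ∑ y, g a y = 1) → ∑ r, slotW g r * K₁ r = ∑ r, slotW g r * K₂ r) :
    ∑ τ : Fin d → Perm (Fin n), K₁ (fun a => ⇑(τ a)) = ∑ τ : Fin d → Perm (Fin n), K₂ (fun a => ⇑(τ a)) := by
  rw [← sub_eq_zero, ← sum_sub_distrib]
  refine sum_perm_eq_zero_of_forall_into (fun r => K₁ r - K₂ r) fun S => ?_
  -- empty `S a`: no family maps into `S`
  by_cases hne : ∀ a, (S a).Nonempty
  swap
  · simp only [not_forall, Finset.not_nonempty_iff_eq_empty] at hne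
    obtain ⟨a, ha⟩ := hne
    refine sum_eq_zero fun r hr => ?_
    rw [mem_filter] at hr
    have := hr.2 a ⟨0, hn⟩
    rw [ha] at this
    exact absurd this (Finset.notMem_empty _)
  -- the uniform weights on `S a`
  set g : Fin d → Fin n → ℝ := fun a y => if y ∈ S a then ((S a).card : ℝ)⁻¹ else 0 with hg
  have hgsum : ∀ a, ∑ y, g a y = 1 := by
    intro a
    simp only [hg]
    rw [Finset.sum_ite_mem, Finset.univ_inter, sum_const, nsmul_eq_mul, mul_inv_cancel₀]
    exact_mod_cast (hne a).card_pos.ne'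
  have hkey : ∑ r : Fin d → Fin n → Fin n, slotW g r * (K₁ r - K₂ r) = 0 := by
    simp only [mul_sub, sum_sub_distrib]
    rw [h g hgsum, sub_self]
  -- the monomial weight is the constant `Π_a |S_a|^{-n}` on families into `S` and `0` elsewhere
  set c : ℝ := ∏ a : Fin d, (((S a).card : ℝ)⁻¹) ^ n with hc
  have hcpos : 0 < c := prod_pos fun a _ => pow_pos (inv_pos.2 (by exact_mod_cast (hne a).card_pos)) _
  have hin : ∀ r : Fin d → Fin n → Fin n, (∀ a j, r a j ∈ S a) → slotW g r = c := by
    intro r hr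
    unfold slotW
    refine prod_congr rfl fun a _ => ?_
    rw [prod_congr rfl fun j _ => show g a (r a j) = ((S a).card : ℝ)⁻¹ by simp [hg, hr a j], prod_const, card_univ,
      Fintype.card_fin]
  have hout : ∀ r : Fin d → Fin n → Fin n, ¬ (∀ a j, r a j ∈ S a) → slotW g r = 0 := by
    intro r hr
    push Not at hr
    obtain ⟨a, j, hj⟩ := hr
    unfold slotW
    exact prod_eq_zero (mem_univ a) (prod_eq_zero (mem_univ j) (by simp [hg, hj]))
  have hw : ∀ r : Fin d → Fin n → Fin n, slotW g r = if (∀ a j, r a j ∈ S a) then c else 0 := by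
    intro r
    split_ifs with hr
    · exact hin r hr
    · exact hout r hr
  simp_rw [hw, ite_mul, zero_mul] at hkey
  rw [← sum_filter, ← mul_sum] at hkey
  exact (mul_eq_zero.1 hkey).resolve_left hcpos.ne'

/-- **`patternForm` is a symmetric function of its `n` arguments**: `patternForm d n (f ∘ π) = patternForm d n f`. [this work] -/
theorem patternForm_perm_slots (f : Fin n → Q d n → ℝ) (π : Perm (Fin n)) :
    patternForm d n (fun i => f (π i)) = patternForm d n f := by
  rcases Nat.eq_zero_or_pos n with rfl | hn
  · have : (fun i => f (π i)) = f := funext fun i => Fin.elim0 i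
    rw [this]
  exact sum_perm_eq_of_forall_gridW hn
    (fun r => diagForm d n (fun i => f (π i) ∘ slotMap r)) (fun r => diagForm d n (fun i => f i ∘ slotMap r))
    (fun g hg => by
      rw [← sahiE_gridW_eq_sum_diagForm g hg hn (fun i => f (π i)), ← sahiE_gridW_eq_sum_diagForm g hg hn f]
      exact sahiE_comp_perm (gridW g) n π f)

/-- **`patternForm` is invariant under relabelling the axes**: `patternForm d n (i ↦ f_i ∘ (q ↦ q ∘ ρ)) = patternForm d n f` for
`ρ ∈ S_d`. [this work] -/
theorem patternForm_comp_axisPerm (f : Fin n → Q d n → ℝ) (ρ : Perm (Fin d)) :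
    patternForm d n (fun i => f i ∘ fun q : Q d n => q ∘ ρ) = patternForm d n f := by
  rcases Nat.eq_zero_or_pos n with rfl | hn
  · -- `Q d 0 → ℝ`: for `d = 0` the axis map is the identity, for `d ≥ 1` the cube is empty
    have : (fun i => f i ∘ fun q : Q d 0 => q ∘ ρ) = f := funext fun i => Fin.elim0 i
    rw [this]
  -- the axis relabelling as equivalences of slot families, of `S_n^d`, and of the cube
  set eR : (Fin d → Fin n → Fin n) ≃ (Fin d → Fin n → Fin n) :=
    ⟨fun r a => r (ρ a), fun r a => r (ρ.symm a), fun r => by funext a; simp, fun r => by funext a; simp⟩ with heR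
  set eT : (Fin d → Perm (Fin n)) ≃ (Fin d → Perm (Fin n)) :=
    ⟨fun τ a => τ (ρ a), fun τ a => τ (ρ.symm a), fun τ => by funext a; simp, fun τ => by funext a; simp⟩ with heT
  set eQ : Q d n ≃ Q d n :=
    ⟨fun q => q ∘ ρ, fun q => q ∘ ρ.symm, fun q => by funext a; simp, fun q => by funext a; simp⟩ with heQ
  have key := sum_perm_eq_of_forall_gridW hn
    (fun r => diagForm d n (fun i => (f i ∘ fun q : Q d n => q ∘ ρ) ∘ slotMap r))
    (fun r => diagForm d n (fun i => f i ∘ slotMap (eR r)))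
    (fun g hg => by
      have hgρ : ∀ a, ∑ y, (g ∘ ρ) a y = 1 := fun a => hg (ρ a)
      -- left: `E_n^{⊗g}(f ∘ axis) = E_n^{⊗(g∘ρ)}(f)` by relabelling the grid
      have hgrid : gridW (g ∘ ρ) ∘ eQ = gridW g := by
        funext x
        simp only [comp_apply, gridW, heQ, Equiv.coe_fn_mk]
        exact Fintype.prod_equiv ρ _ _ fun a => rfl
      have hleft : sahiE (gridW g) n (fun i => f i ∘ fun q : Q d n => q ∘ ρ) = sahiE (gridW (g ∘ ρ)) n f := by
        rw [← hgrid]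
        exact sahiE_comp_equiv eQ (gridW (g ∘ ρ)) n f
      rw [← sahiE_gridW_eq_sum_diagForm g hg hn, hleft, sahiE_gridW_eq_sum_diagForm (g ∘ ρ) hgρ hn f, ← eR.sum_comp]
      refine Fintype.sum_congr _ _ fun r => ?_
      have hw : slotW (g ∘ ρ) (eR r) = slotW g r := by
        unfold slotW
        simp only [heR, Equiv.coe_fn_mk, comp_apply]
        exact Fintype.prod_equiv ρ _ _ fun a => rfl
      rw [hw])
  -- left sum = `patternForm (f ∘ axis)`, right sum = `patternForm f` after `τ ↦ τ ∘ ρ`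
  have hR : ∑ τ : Fin d → Perm (Fin n), diagForm d n (fun i => f i ∘ slotMap (eR fun a => ⇑(τ a))) = patternForm d n f := by
    unfold patternForm
    rw [← eT.sum_comp (fun τ => diagForm d n fun i => f i ∘ act τ)]
    rfl
  rw [← hR, ← key]
  rfl

/-- **`sStarN` is symmetric in its `n` arguments** (transfer through `sStarN_cast_eq_patternForm`). [this work] -/
theorem sStarN_perm_slots (A : Fin n → Finset (Q d n)) (π : Perm (Fin n)) :
    sStarN n d (fun i => A (π i)) = sStarN n d A := by
  rcases Nat.eq_zero_or_pos n with rfl | hn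
  · have : (fun i => A (π i)) = A := funext fun i => Fin.elim0 i
    rw [this]
  have h := patternForm_perm_slots (fun i => setInd (A i)) π
  rw [← sStarN_cast_eq_patternForm hn A, ← sStarN_cast_eq_patternForm hn (fun i => A (π i))] at h
  exact_mod_cast h

/-- **`sStarN` is invariant under relabelling the axes**: pulling every `A_i` back along `q ↦ q ∘ ρ` does not change `sStarN`.
[this work] -/
theorem sStarN_axisPerm (A : Fin n → Finset (Q d n)) (ρ : Perm (Fin d)) :
    sStarN n d (fun i => univ.filter fun q : Q d n => q ∘ ρ ∈ A i) = sStarN n d A := by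
  rcases Nat.eq_zero_or_pos n with rfl | hn
  · have : (fun i => univ.filter fun q : Q d 0 => q ∘ ⇑ρ ∈ A i) = A := funext fun i => Fin.elim0 i
    rw [this]
  have hind : (fun i => setInd (univ.filter fun q : Q d n => q ∘ ρ ∈ A i)) = fun i => setInd (A i) ∘ fun q : Q d n => q ∘ ρ := by
    funext i q
    simp [setInd, mem_filter]
  have h := patternForm_comp_axisPerm (fun i => setInd (A i)) ρ
  rw [← hind, ← sStarN_cast_eq_patternForm hn A, ← sStarN_cast_eq_patternForm hn] at h
  exact_mod_cast h

/-- **Comb transfer**: `(∀ d, PatternPosN n d) → MasterFamilyCombPos n` — the order-`n` row of the comb (Bernstein) table for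
up-set families on finite Boolean cubes follows from the `prim-sahi` predicate in every dimension
(`masterFamilyCombPos_of_forall_slotPatternPos` through `patternPosN_iff_slotPatternPos`). [this work] -/
theorem masterFamilyCombPos_of_forall_patternPosN (h : ∀ d, SahiGridPatternN.PatternPosN n d) :
    MasterFamilyCombPos n :=
  masterFamilyCombPos_of_forall_slotPatternPos fun d => patternPosN_iff_slotPatternPos.1 (h d)

end Symmetry

section FaceTransfer

open SahiGridPatternN (sStarN)
open scoped Classical

variable {d n : ℕ}

/-- **Slot face theorem, absorbed member in slot `k`**: `U_k ⊆ U_j` for all `j` ⟹ `patternForm d (n+1) (1_U) ≥ 0`. [this work] -/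
theorem patternForm_setInd_nonneg_of_subset_at (U : Fin (n + 1) → Finset (Q d (n + 1))) (k : Fin (n + 1))
    (hU : ∀ j, U k ⊆ U j) : 0 ≤ patternForm d (n + 1) (fun i => setInd (U i)) := by
  rw [← patternForm_perm_slots (fun i => setInd (U i)) (Equiv.swap 0 k)]
  refine patternForm_setInd_nonneg_of_subset (fun i => U (Equiv.swap 0 k i)) fun j => ?_
  simp only [swap_apply_left]
  exact hU _

/-- **Slot face theorem for `sStarN`**: `A_k ⊆ A_j` for all `j` ⟹ `sStarN (n+1) d A ≥ 0` (arbitrary finsets). [this work] -/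
theorem sStarN_nonneg_of_subset (A : Fin (n + 1) → Finset (Q d (n + 1))) (k : Fin (n + 1)) (hA : ∀ j, A k ⊆ A j) :
    0 ≤ sStarN (n + 1) d A := by
  have h := patternForm_setInd_nonneg_of_subset_at A k hA
  rw [← sStarN_cast_eq_patternForm (by omega) A] at h
  exact_mod_cast h

/-- **Coefficientwise form on every grid**: every coefficient `patternForm d (n+1) (f ∘ slot_r)` of the bridge expansion
`|S_{n+1}^d| · E_{n+1}^{⊗g}(f) = Σ_r (Π g_a(r_a j)) · patternForm(f ∘ slot_r)` (`card_mul_sahiE_gridW_eq_sum_patternForm`) is `≥ 0` for an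
absorbed family `f` on ANY `d`-dimensional grid `Y^d` — `Z^{n+1}E_{n+1}` has nonnegative coefficients in the chain weights for absorbed
families (pull-backs of absorbed families are absorbed). [this work] -/
theorem patternForm_pullback_nonneg_of_absorbed {Y : Type*} (f : Fin (n + 1) → (Fin d → Y) → ℝ) (hf0 : ∀ x, 0 ≤ f 0 x)
    (habs : ∀ j : Fin n, ∀ x, f 0 x * f j.succ x = f 0 x) (h01 : ∀ j : Fin n, ∀ x, 0 ≤ f j.succ x ∧ f j.succ x ≤ 1)
    (r : Fin d → Fin (n + 1) → Y) : 0 ≤ patternForm d (n + 1) (fun i => f i ∘ slotMap r) :=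
  patternForm_nonneg_of_absorbed _ (fun _ => hf0 _) (fun j _ => habs j _) (fun j _ => h01 j _)

/-! ### The first-slot profile: `patternForm` is linear in each argument -/

/-- **Linearity in the head slot**: `diagForm d (n+1) (g, F) = Σ_y g(y) · diagForm d (n+1) (1_{{y}}, F)`. [this work] -/
theorem diagForm_cons_eq_sum_single (g : Q d (n + 1) → ℝ) (F : Fin n → Q d (n + 1) → ℝ) :
    diagForm d (n + 1) (Fin.cons g F) = ∑ y : Q d (n + 1), g y * diagForm d (n + 1) (Fin.cons (setInd {y}) F) := by
  unfold diagForm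
  simp_rw [mul_sum]
  rw [sum_comm]
  refine sum_congr rfl fun σ _ => ?_
  simp_rw [Fin.prod_univ_succ, Fin.cons_zero, Fin.cons_succ]
  have hg : g (diag (rep σ 0)) = ∑ y : Q d (n + 1), g y * setInd {y} (diag (d := d) (rep σ 0)) := by
    simp_rw [setInd_apply, mem_singleton, mul_ite, mul_one, mul_zero]
    rw [Finset.sum_ite_eq univ (diag (rep σ 0)), if_pos (mem_univ _)]
  rw [hg, sum_mul, mul_sum]
  refine sum_congr rfl fun y _ => ?_
  ring

/-- **The profile decomposition of the pattern functional**: `patternForm d (n+1) (g, F) = Σ_y g(y) · P_y(F)` with the slot PROFILE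
`P_y(F) = patternForm d (n+1) (1_{{y}}, F)`; by `patternForm_single_nonneg`, `P_y ≥ 0` at every `y` lying in all the `U_j` (SIGN⁺), and the
exact one-slot minimisation of the censuses is `min_D Σ_{y∈D} P_y`. [this work] -/
theorem patternForm_cons_eq_sum_profile (g : Q d (n + 1) → ℝ) (F : Fin n → Q d (n + 1) → ℝ) :
    patternForm d (n + 1) (Fin.cons g F) =
      ∑ y : Q d (n + 1), g y * patternForm d (n + 1) (Fin.cons (setInd {y}) F) := by
  unfold patternForm
  have hcons : ∀ (g' : Q d (n + 1) → ℝ) (τ : Fin d → Perm (Fin (n + 1))),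
      (fun i => (Fin.cons g' F : Fin (n + 1) → Q d (n + 1) → ℝ) i ∘ act τ) = Fin.cons (g' ∘ act τ) (fun j => F j ∘ act τ) := by
    intro g' τ
    funext i
    refine Fin.cases ?_ (fun j => ?_) i
    · rfl
    · simp only [Fin.cons_succ]
  -- per relabelling: linearity in the head, then re-index the point `y ↦ τ·y`
  have hτ : ∀ τ : Fin d → Perm (Fin (n + 1)),
      diagForm d (n + 1) (Fin.cons (g ∘ act τ) (fun j => F j ∘ act τ)) =
        ∑ y : Q d (n + 1), g y * diagForm d (n + 1) (Fin.cons (setInd {y} ∘ act τ) (fun j => F j ∘ act τ)) := by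
    intro τ
    have hbij : Function.Bijective (act τ : Q d (n + 1) → Q d (n + 1)) := by
      refine (Finite.injective_iff_bijective).1 fun q q' hqq' => ?_
      funext a
      exact (τ a).injective (congrFun hqq' a)
    set e : Q d (n + 1) ≃ Q d (n + 1) := Equiv.ofBijective _ hbij with he
    rw [diagForm_cons_eq_sum_single, ← e.symm.sum_comp]
    refine sum_congr rfl fun z _ => ?_
    have h1 : (g ∘ act τ) (e.symm z) = g z := by
      show g (e (e.symm z)) = g z
      rw [Equiv.apply_symm_apply]
    have h2 : (setInd {e.symm z} : Q d (n + 1) → ℝ) = setInd {z} ∘ act τ := by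
      funext q
      simp only [comp_apply, setInd_apply, mem_singleton]
      have hiff : q = e.symm z ↔ act τ q = z := by
        rw [Equiv.eq_symm_apply]
        rfl
      simp only [hiff]
    rw [h1, h2]
  simp_rw [hcons]
  rw [sum_congr rfl fun τ _ => hτ τ]
  simp_rw [mul_sum]
  exact sum_comm

end FaceTransfer

end SahiSlot

end Summit.CriticalPhenomena.PercolationContinuityZ3.Theorems
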